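import Mathlib
import HarnessLib
import Summits.Parity.GeneralizedHardyLittlewood.Statement
import Literature.NumberTheory.Sieve.LinearEquationsInPrimes
import Literature.NumberTheory.Sieve.SingularSeries
import Literature.Barriers.Parity.SiegelZeroDichotomy
import Literature.Barriers.Parity.SiegelZeroPrimePairs

/-!
# Sketch — first lemmas for the crux idea cards on `PairsToGHL` (stmt-Parity-9389), ideator 1, round 1

IMPORT-LIGHT published copy: it does not import the route module (the farm reported the route build
incoherent at publication time); the three route decls it needs (`PairsToGHL`, `MAvg`, `BVLiouville`)
are re-spelled VERBATIM below as `PairsToGHL'`, `MAvg'`, `BVLiouville'`. The ideator-folder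
`Sketch.lean` is the same file importing `…Theses.LiouvilleShiftedTables` and citing the three decls
BY NAME (farm rc 0, 2026-08-16T04:4xZ; attached as evidence `Sketch-ideator1.lean` earlier).

Crux (fixed): `Theses.LiouvilleShiftedTables.PairsToGHL = (PairsHL → GeneralizedHardyLittlewood)`
(shared decl of routes RoughSemiprimeRigidity / LiouvilleMAD / LiouvilleShiftedTables / HullDial).

Contents
* `PairsHL`                      — the crux hypothesis, verbatim; `pairsToGHL_iff` (rfl check).
* Card `bombieri-ladder-liouville-atoms`:
  `HLFixed`, `TupleMAvg` (the t-fold Bombieri level-1 residual = `MAvg` at t = 1, `tupleMAvg_singleton`),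
  `TupleLevelRoot` (root-class relative tuple level, the slice of `TupleLevelOne` the rung uses),
  `rung` (general fixed-shift rung, signature) and `rung_two_of_pairs` (the rung that consumes the
  crux hypothesis `PairsHL` as Bombieri's mass axiom).
* Card `second-slot-divisor-weight`:
  the weight classes `shiftWeightI` / `shiftWeightII` / `IsAdmissibleWeight`, `WeightedDilatedTables`
  (route item `DilatedTableChowla` with a shifted restricted-divisor weight), `WeightedTypeI2` (route
  item `TypeI2Dilated` with a kind-I weight), and `engine_two` (signature): `BVLiouville → WeightedDilatedTables → WeightedTypeI2 →
  TupleMAvg {a, b}`.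
* Barrier note (not a card): `ghl_bounds_siegel_quality` — any proof of the crux proves
  `PairsHL → ¬ UnboundedSiegelZeros` (signature; Matomäki–Merikoski Thm 1.3 at h = 2q, X = q^10).
`pairsHL_iff_hlFixed`, `tupleMAvg_singleton`, `pairsToGHL_iff`, `pairsToGHL_bounds_siegel_quality` are PROVED;
`rung`, `rung_two_of_pairs`, `engine_two`, `ghl_bounds_siegel_quality` are SIGNATURES (`sorry`); all defs elaborate.
-/

namespace Summit.Parity.GeneralizedHardyLittlewood.Cruxes.PairsToGHL.Ideator1

open scoped BigOperators ArithmeticFunction.vonMangoldt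
open Filter Finset Literature.NumberTheory.Sieve

/-! ### Verbatim copies of the three route decls used (route LiouvilleShiftedTables) -/

/-- VERBATIM copy of `Theses.LiouvilleShiftedTables.PairsToGHL` (the crux, stmt-Parity-9389); the route file
writes `GeneralizedHardyLittlewood` inside its own namespace where it resolves to `_root_.…` (the abbrev). -/
def PairsToGHL' : Prop :=
  (∀ h : ℕ, 1 ≤ h → (fun N : ℕ => ∑ n ∈ Finset.Icc 1 N, ArithmeticFunction.vonMangoldt n * ArithmeticFunction.vonMangoldt (n + h) - Literature.NumberTheory.Sieve.singularSeries ({0, (h : ℤ)} : Finset ℤ) * N) =o[Filter.atTop] fun N : ℕ => (N : ℝ)) → _root_.GeneralizedHardyLittlewood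

/-- VERBATIM copy of `Theses.LiouvilleShiftedTables.MAvg` (= stmt-Parity-0613 by signature). -/
def MAvg' : Prop :=
  ∀ h : ℕ, 1 ≤ h → ∃ ε : ℝ, 0 < ε ∧ (fun x : ℝ => ∑ m ∈ Finset.Icc 1 ⌊x ^ ε⌋₊, Real.log m * |∑ d ∈ Finset.Icc 1 ⌊x / m⌋₊, (ArithmeticFunction.moebius d : ℝ) * ArithmeticFunction.vonMangoldt (d * m + h)|) =o[Filter.atTop] fun x : ℝ => x

/-- VERBATIM copy of `Theses.LiouvilleShiftedTables.BVLiouville` (stmt-Parity-13324, PROVED in tree). -/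
def BVLiouville' : Prop :=
  ∀ ε : ℝ, 0 < ε → ∀ A : ℝ, 0 < A → ∃ C x₀ : ℝ, ∀ x : ℝ, x₀ ≤ x → ∀ c : ℕ → ℤ, ∀ y : ℕ → ℝ, (∀ d, 1 ≤ d → 0 ≤ c d ∧ c d < d) → (∀ d, 0 ≤ y d ∧ y d ≤ x) → (∑ d ∈ Finset.Icc 1 ⌊x ^ (1 / 2 - ε)⌋₊, |∑ n ∈ Finset.Icc 1 ⌊y d / d⌋₊, (ArithmeticFunction.liouville (Int.toNat ((d : ℤ) * n + c d)) : ℝ)|) ≤ C * x / Real.log x ^ A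

/-! ### The crux hypothesis -/

/-- Hardy–Littlewood pairs, Λ-form, fixed shift, slope 1 (the hypothesis of the crux, verbatim). -/
def PairsHL : Prop :=
  ∀ h : ℕ, 1 ≤ h → (fun N : ℕ => ∑ n ∈ Finset.Icc 1 N, Λ n * Λ (n + h) -
    singularSeries ({0, (h : ℤ)} : Finset ℤ) * N) =o[atTop] fun N : ℕ => (N : ℝ)

theorem pairsToGHL_iff :
    PairsToGHL' ↔ (PairsHL → _root_.GeneralizedHardyLittlewood) :=
  Iff.rfl

/-! ### Card A — the Bombieri ladder with Liouville/Möbius atoms -/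

/-- Hardy–Littlewood for the FIXED slope-1 tuple `H ⊆ ℕ` (Λ-form, interval `[1, N]`, `o(N)`). -/
def HLFixed (H : Finset ℕ) : Prop :=
  (fun N : ℕ => ∑ n ∈ Finset.Icc 1 N, (∏ h ∈ H, Λ (n + h)) -
    singularSeries (H.image (fun h : ℕ => (h : ℤ))) * N) =o[atTop] fun N : ℕ => (N : ℝ)

/-- `PairsHL` is `HLFixed {0, h}` for all `h ≥ 1` (bookkeeping: `∏` over `{0, h}`; proved). -/
theorem pairsHL_iff_hlFixed : PairsHL ↔ ∀ h : ℕ, 1 ≤ h → HLFixed {0, h} := by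
  refine forall₂_congr fun h hh => ?_
  have h0 : (0 : ℕ) ∉ ({h} : Finset ℕ) := by
    simp only [Finset.mem_singleton]; omega
  simp only [HLFixed, Finset.prod_insert h0, Finset.prod_singleton, add_zero, Finset.image_insert,
    Finset.image_singleton, Nat.cast_zero]

/-- **The t-fold Bombieri atom** `TupleMAvg H`: Möbius is orthogonal to the prime tuple `H` along
every dilation `m ≤ x^ε`, on log-weighted ℓ¹-average over `m`:
`∃ ε > 0, Σ_{m ≤ x^ε} log m · |Σ_{d ≤ x/m} μ(d) ∏_{h ∈ H} Λ(dm + h)| = o(x)`.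
For `H = {h}` this is the route item `MAvg` (= stmt-Parity-0613); it is the level-1 residual of
Bombieri's asymptotic sieve for the sequence `a_n = ∏_{h∈H} Λ(n + h)` when one more prime `n` is
adjoined (Hardy–Littlewood–Chowla shape `HLC(1 μ, #H Λ)` along dilations). -/
def TupleMAvg (H : Finset ℕ) : Prop :=
  ∃ ε : ℝ, 0 < ε ∧ (fun x : ℝ => ∑ m ∈ Finset.Icc 1 ⌊x ^ ε⌋₊, Real.log m *
    |∑ d ∈ Finset.Icc 1 ⌊x / m⌋₊, (ArithmeticFunction.moebius d : ℝ) *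
      ∏ h ∈ H, Λ (d * m + h)|) =o[atTop] fun x : ℝ => x

/-- Sanity: the singleton atom is the route's `MAvg` summand-for-summand. -/
theorem tupleMAvg_singleton :
    (∀ h : ℕ, 1 ≤ h → TupleMAvg {h}) ↔ MAvg' := by
  simp only [TupleMAvg, MAvg', Finset.prod_singleton]

/-- Admissible-class weight for the ROOT class `n ≡ 0 (mod d)` of the adjoined form `n`, relative
to the tuple `H`: `1/#{ρ mod d : (ρ + h, d) = 1 ∀ h ∈ H}` if `(h, d) = 1` for all `h ∈ H`, else `0`. -/
noncomputable def rootWeight (H : Finset ℕ) (d : ℕ) : ℝ :=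
  if ∀ h ∈ H, Nat.Coprime h d then
    (((Finset.range d).filter (fun ρ => ∀ h ∈ H, Nat.Coprime (ρ + h) d)).card : ℝ)⁻¹ else 0

/-- **Root-class tuple level** (the slice of `TupleLevelOne`, stmt-Parity-14833, that the rung
consumes — cf. the TupleLevelOne ideator-3 memo, M3): the prime tuple `H` is equidistributed in the
root classes `n ≡ 0 (mod d)` to level `N^{1-δ}` with log-power saving, RELATIVE to its own mass
(no main term assumed): for every `δ, B > 0`,
`Σ_{d ≤ N^{1-δ}} |Σ_{n ≤ y_d, d ∣ n} F_H(n) − w_H(d) Σ_{n ≤ y_d} F_H(n)| ≤ C N/(log N)^B`. -/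
def TupleLevelRoot (H : Finset ℕ) : Prop :=
  ∀ δ B : ℝ, 0 < δ → 0 < B → ∃ C : ℝ, ∀ N : ℕ, 2 ≤ N → ∀ y : ℕ → ℕ, (∀ d, y d ≤ N) →
    (∑ d ∈ Finset.Icc 1 ⌊(N : ℝ) ^ (1 - δ)⌋₊,
      |(∑ n ∈ (Finset.Icc 1 (y d)).filter (fun n => d ∣ n), ∏ h ∈ H, Λ (n + h)) -
        rootWeight H d * ∑ n ∈ Finset.Icc 1 (y d), ∏ h ∈ H, Λ (n + h)|) ≤
      C * N / Real.log N ^ B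

/-- **Card A, first lemma (general rung, fixed shifts).** Bombieri's asymptotic sieve at level 1
on the sequence `a_n = ∏_{h ∈ H} Λ(n + h)`, sieving the adjoined form `n`:
mass (`HLFixed H`) + root-class level (`TupleLevelRoot H`) + atom (`TupleMAvg H`) give
`HLFixed (insert 0 H)`. Provable bookkeeping (the t-fold `PairsFromMAvg`): `Λ = μ ∗ log`,
split `m ≤ N^{ε}` (atom) / `m > N^{ε}` (level + mass), Euler-product identity
`-Σ_d μ(d) w_H(d) log d = 𝔖(0 ∪ H)/𝔖(H)`. -/
theorem rung (H : Finset ℕ) (hH : H.Nonempty) (h0 : 0 ∉ H) :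
    HLFixed H → TupleLevelRoot H → TupleMAvg H → HLFixed (insert 0 H) := by
  sorry

/-- **Card A, the rung that uses the crux hypothesis.** `PairsHL` is the mass axiom of Bombieri's
sieve for the twin-type sequence `Λ(n+a)Λ(n+b)` (shift-invariance `{a,b} ↦ {0, b-a}` is part of
the bookkeeping), so with the root-class level and the 2-fold atom it yields prime TRIPLES
`(n, n+a, n+b)` with the Hardy–Littlewood constant. -/
theorem rung_two_of_pairs (a b : ℕ) (ha : 1 ≤ a) (hab : a < b) :
    PairsHL → TupleLevelRoot {a, b} → TupleMAvg {a, b} → HLFixed {0, a, b} := by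
  sorry

/-! ### Card B — absorb the second slot as a shifted restricted-divisor weight -/

/-- Type-I / Type-I₂-shaped shift weight: `R(k) = Σ_{e ∣ k, E < e ≤ 2E, k ≤ Y·e} γ(e)` — a restricted
divisor sum with divisor-bounded coefficients and a monotone cut-off in the complementary divisor
(what a Heath-Brown Type-I or Type-I₂ piece of the SECOND slot looks like as a function of the first
slot's variable, after partial summation of the smooth weights). -/
noncomputable def shiftWeightI (γ : ℕ → ℝ) (E Y : ℝ) (k : ℕ) : ℝ :=
  ∑ e ∈ (Nat.divisors k).filter (fun e : ℕ => E < (e : ℝ) ∧ (e : ℝ) ≤ 2 * E ∧ (k : ℝ) ≤ Y * e), γ e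

/-- Type-II-shaped shift weight: `R(k) = Σ_{e ∣ k, E < e ≤ 2E} γ(e) θ(k/e)` with BOTH coefficient
sequences arbitrary bounded — admissible only for `E` inside the Type-II window (else `θ` alone could
encode `λ` of the other shifted copy: `E = 1` would make `R` an arbitrary function of `k/2`). -/
noncomputable def shiftWeightII (γ θ : ℕ → ℝ) (E : ℝ) (k : ℕ) : ℝ :=
  ∑ e ∈ (Nat.divisors k).filter (fun e : ℕ => E < (e : ℝ) ∧ (e : ℝ) ≤ 2 * E), γ e * θ (k / e)

/-- The admissible weight class 𝓡(x, δ): kind I with any level `1 ≤ E ≤ x^{1/2+3δ}`, or kind II with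
`E` in the table window `[x^δ, x^{1/3+δ}]`; coefficients `|γ(e)| ≤ τ(e)`, `|θ| ≤ 1`. -/
def IsAdmissibleWeight (x δ : ℝ) (R : ℕ → ℝ) : Prop :=
  (∃ (γ : ℕ → ℝ) (E Y : ℝ), (∀ e, |γ e| ≤ (Nat.divisors e).card) ∧ 1 ≤ E ∧ E ≤ x ^ (1 / 2 + 3 * δ) ∧
      R = shiftWeightI γ E Y) ∨
  (∃ (γ θ : ℕ → ℝ) (E : ℝ), (∀ e, |γ e| ≤ (Nat.divisors e).card) ∧ (∀ k, |θ k| ≤ 1) ∧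
      x ^ δ ≤ E ∧ E ≤ x ^ (1 / 3 + δ) ∧ R = shiftWeightII γ θ E)

/-- **Weighted dilated tables** (route item `DilatedTableChowla`: same window `A ∈ [x^δ, x^{1/3+δ}]`,
same ℓ¹ form `Σ_{q ≤ x^{δ/2}} q³ · (sup over classes)`, same log-power claim) with every entry
multiplied by an admissible shift weight of a SECOND shifted copy: `λ(ab+c)·R(ab+c')`, `c' ≠ c`. -/
def WeightedDilatedTables : Prop :=
  ∀ c c' : ℤ, c ≠ 0 → c' ≠ c → ∀ δ : ℝ, 0 < δ → δ ≤ 1 / 12 → ∀ C : ℝ, 0 < C → ∃ x₀ : ℝ, ∀ x : ℝ, x₀ ≤ x →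
    ∀ A : ℝ, x ^ δ ≤ A → A ≤ x ^ (1 / 3 + δ) → ∀ R : ℕ → ℝ, IsAdmissibleWeight x δ R → ∀ u v : ℕ → ℕ,
      (∑ q ∈ Finset.Icc 1 ⌊x ^ (δ / 2)⌋₊, (q : ℝ) ^ 3 *
        ∑ a ∈ (Finset.Ioc ⌊A⌋₊ ⌊2 * A⌋₊).filter (fun a : ℕ => a ≡ u q [MOD q]),
        ∑ a' ∈ (Finset.Ioc ⌊A⌋₊ ⌊2 * A⌋₊).filter (fun a' : ℕ => a' ≡ u q [MOD q]),
          (∑ b ∈ (Finset.Icc 1 ⌊x / A⌋₊).filter (fun b : ℕ => b ≡ v q [MOD q]),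
            (ArithmeticFunction.liouville (Int.toNat ((a : ℤ) * b + c)) : ℝ) *
            R (Int.toNat ((a : ℤ) * b + c')) *
            ((ArithmeticFunction.liouville (Int.toNat ((a' : ℤ) * b + c)) : ℝ) *
            R (Int.toNat ((a' : ℤ) * b + c')))) ^ 2) ≤
        x ^ 2 / Real.log x ^ C

/-- **Weighted Type I₂** (route item `TypeI2Dilated`, same ranges) with the summand multiplied by a
kind-I admissible shift weight of a second shifted copy: `λ(rsn + c)·R(rsn + c')`, `c' ≠ c`. -/
def WeightedTypeI2 : Prop :=
  ∀ c c' : ℤ, c ≠ 0 → c' ≠ c → ∃ ρ : ℝ, 0 < ρ ∧ ∀ A : ℝ, 0 < A → ∃ C x₀ : ℝ, ∀ x : ℝ, x₀ ≤ x →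
    ∀ (γ : ℕ → ℝ) (E Y : ℝ), (∀ e, |γ e| ≤ (Nat.divisors e).card) → 1 ≤ E → E ≤ x ^ (1 / 2 + 3 * ρ) →
    ∀ w : ℕ, ∀ R S y : ℝ, 1 ≤ R → R ≤ x ^ ρ → 0 ≤ S → S * R ≤ x ^ (1 / 2 + ρ) → 0 ≤ y → y ≤ x →
      (∑ q ∈ Finset.Icc 1 ⌊x ^ ρ⌋₊, ∑ r ∈ Finset.Icc 1 ⌊R⌋₊,
        |∑ s ∈ Finset.Icc 1 ⌊S⌋₊, ∑ n ∈ (Finset.Icc 1 ⌊y / (s * r)⌋₊).filter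
            (fun n : ℕ => r * s * n ≡ w [MOD q]),
          (ArithmeticFunction.liouville (Int.toNat ((r : ℤ) * s * n + c)) : ℝ) *
          shiftWeightI γ E Y (Int.toNat ((r : ℤ) * s * n + c'))|) ≤ C * x / Real.log x ^ A

/-- **Card B, first lemma (signature).** Two-slot Heath-Brown with `μ/λ` kept whole, for the rung-2
atom `TupleMAvg {a, b}`: after `μ(d) = λ(d)Σ_{k²∣d}μ(k)` and `λ(n/m) = λ(n)λ(m)` the atom is
`Σ_{q ≤ x^{2ε}} |Σ_{n ≤ x, q ∣ n} λ(n)Λ(n+a)Λ(n+b)| ≪ x/(log x)^6`; open BOTH `Λ`'s (K₀ = 3); pieces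
`I'×I'` (Type-I parts `≤ x^{1/4−2ε}` each) are `BVLiouville`; in every other piece the second slot's
piece is an admissible shift weight `R(· + b − a)` (kind I from Type-I/I₂ slots, kind II from
Type-II slots), so the piece is a weighted dilated table (`× II`) or a weighted Type I₂ (`× I₂'`,
incl. the `I₂'×I₂'` corner). -/
theorem engine_two (a b : ℕ) (ha : 1 ≤ a) (hab : a < b) :
    BVLiouville' → WeightedDilatedTables → WeightedTypeI2 →
      TupleMAvg {a, b} := by
  sorry


/-! ### Barrier note (obstruction side, not a card): the Siegel content is provably inside -/

/-- Any proof of the crux proves `PairsHL → ¬ UnboundedSiegelZeros`: GHL at `d = 1`, `t = 2`,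
system `(n, n + 2q)`, `N = X = q^{10}`, `L = 3`, against Matomäki–Merikoski Thm 1.3 (correction
factor `2` at `h = 2q`, `q` odd) for `η` large. Signature for the standing disprover. -/
theorem ghl_bounds_siegel_quality
    (hMM : Literature.Barriers.Parity.MatomakiMerikoski2023_pairCorrelation)
    (hG : _root_.GeneralizedHardyLittlewood) :
    ¬ Literature.Barriers.Parity.UnboundedSiegelZeros := by
  sorry

/-- Hence the crux plus its own hypothesis bound the quality of Siegel zeros (pure logic from the
previous signature). -/
theorem pairsToGHL_bounds_siegel_quality
    (hMM : Literature.Barriers.Parity.MatomakiMerikoski2023_pairCorrelation)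
    (hcrux : PairsToGHL') (hP : PairsHL) :
    ¬ Literature.Barriers.Parity.UnboundedSiegelZeros :=
  ghl_bounds_siegel_quality hMM (hcrux hP)

end Summit.Parity.GeneralizedHardyLittlewood.Cruxes.PairsToGHL.Ideator1
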